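import Summits.AtomisticToContinuum.Crystallization.Theorems.ChartedZeroExcessLayeredLatticeLiouvilleZZZYRCZV

/-!
# Charted zero-excess layered-lattice Liouville — ZZZYRCZW: the WINDOWED θ⁰ near reader, THE THEOREM (`thetaReaderNearF_holds`) and the
kernel corollary

Cell `decomp-a2c`, lens 2 («special vs generic»), generation 100.  Line (D) TAIL-DEBIT of `UniformEquilStabilityAt`, item 5c, R3-W.
With the kit of ZZZYRCZV: given, for every base layer `m`, valid window data `cdW m` (centre `H₀`, path radius `R`, ZZZYRCZU
`ChordDataValidF`) under the re-based sequence `winSeq ℓ H₀ m` and real majorants `TRm m`, `TNm m` of the GUARDED tables (`WindowDataF`),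
the letter-function comparisons `IdealLengthCmpF ℓ λ μ`, `IdealAngleCmpF ℓ K η` (ZZZYRCZO/RCZP) and the scalar side conditions
`μ²·P9max ≤ 9ϱ²`, `μ²·lo ≤ 9ϱ²`, `0 ≤ ϱ`, the path system READ OFF the data is a path system on the far ideal-near pairs of `ℓ` and the scheme
is dominated there by the LAYER SUMS `Θ_R(y) = (1+α)λ⁻⁸·Σ_{|m − y.1.2| ≤ R} TRm m (keyAtF H₀ m y)` and
`Θ_N(y) = (1+α⁻¹)λ⁻⁸·Σ_{|m − y.1.2| ≤ R} (K·TNm m + η·TRm m)(keyAtF H₀ m y)` (`thetaReaderNearF_holds`).  Proof: incidences with piece `y`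
are fibred over the base layer `m = x.1.2`; on each fibre the counting lemma of ZZZYRCZ against the window data `cdW m` (injectivity through
the window translation, the guard through `n9F ℓ x = n9F ℓₘ c.1 ∈ (lo, hi]`) gives `κ·θ0G(ℓₘ)(keyAtF H₀ m y)`, which vanishes unless
`|m − y.1.2| ≤ R` and is non-negative, so the fibre sum over the base layers met by `X` is at most the sum over the radius window.
`windowDataF_of_kernel`: the windowed kernel contract `KernelSlabSoundF` (ZZZYRCZU) of the window TYPES `windowWord ℓ (m − H₀) (2H₀+1)`
gives the window data with dyadic majorants (`AgreesOnWindow` by `regW_windowWord`); `thetaReaderNearF_of_kernel` = the two composed —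
what a letter-function box certificate invokes.  «LOOKUP-SUM» (for the K-file): `sup_y Θ_R(y) ≤ (1+α)λ⁻⁸·max_{(Δγ,Δm)} Σ_d max_ω TR(ω)(d,Δγ,Δm)`.

Theorem file (3 defs, 3 theorems); imports ZZZYRCZV only; no instance / notation / option; 0 sorry. [g100]
-/

namespace Summit.AtomisticToContinuum.Crystallization.Theorems.ChartedZeroExcessLayeredLatticeLiouville

open scoped BigOperators RealInnerProductSpace
open Summit.AtomisticToContinuum.Crystallization.Theorems.ChartedPlanarOrderRigidityDoor (E3)

/-! ### §6 the window data, the reader theorem, and the kernel corollary -/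

/-- ★ WINDOW DATA of the letter sequence `ℓ` (centre `H₀`, radius `R`, ideal range `(lo, hi]`, piece bound `P9max`): for every base layer `m`,
valid window data under the re-based sequence and real majorants of the two guarded tables. [g100] -/
def WindowDataF (H₀ R : ℕ) (ℓ : ℤ → ℤ) (lo hi P9max : ℤ) (cdW : ℤ → List ChordDatum) (TRm TNm : ℤ → ℤ × ℤ × ℤ × ℤ → ℝ) : Prop :=
  ∀ m : ℤ, ChordDataValidF H₀ R (winSeq ℓ H₀ m) lo hi P9max (cdW m) ∧
    ∀ k, thetaR0G (winSeq ℓ H₀ m) lo hi (cdW m) k ≤ TRm m k ∧ thetaN0G (winSeq ℓ H₀ m) lo hi (cdW m) k ≤ TNm m k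

/-- the LAYER-SUM R majorant `(1+α)λ⁻⁸·Σ_{|m − y.1.2| ≤ R} TRm m (keyAtF H₀ m y)`. [g100] -/
noncomputable def thetaSumR (H₀ R : ℕ) (α lam : ℝ) (TRm : ℤ → ℤ × ℤ × ℤ × ℤ → ℝ) (y : (Cell 2 × ℤ) × (Cell 2 × ℤ)) : ℝ :=
  (1 + α) * (lam ^ 8)⁻¹ * ∑ m ∈ Finset.Icc (y.1.2 - R) (y.1.2 + R), TRm m (keyAtF H₀ m y)

/-- the LAYER-SUM N majorant `(1+α⁻¹)λ⁻⁸·Σ_{|m − y.1.2| ≤ R} (K·TNm m + η·TRm m)(keyAtF H₀ m y)`. [g100] -/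
noncomputable def thetaSumN (H₀ R : ℕ) (α lam K η : ℝ) (TRm TNm : ℤ → ℤ × ℤ × ℤ × ℤ → ℝ) (y : (Cell 2 × ℤ) × (Cell 2 × ℤ)) : ℝ :=
  (1 + α⁻¹) * (lam ^ 8)⁻¹ * ∑ m ∈ Finset.Icc (y.1.2 - R) (y.1.2 + R), (K * TNm m (keyAtF H₀ m y) + η * TRm m (keyAtF H₀ m y))

/-- ★★★ THE WINDOWED NEAR READER: window data + the letter-function comparisons + the scalar side conditions ⇒ the path system read off the
data is a path system on the far ideal-near pairs of `ℓ`, and the scheme is dominated there by the layer-sum majorants. [g100] -/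
theorem thetaReaderNearF_holds {H₀ R : ℕ} {ℓ : ℤ → ℤ} {lo hi P9max : ℤ} {cdW : ℤ → List ChordDatum} {TRm TNm : ℤ → ℤ × ℤ × ℤ × ℤ → ℝ}
    {ϱ α lam mu K η : ℝ} {a b : E3} {w : ℤ → E3} (hϱ : 0 ≤ ϱ) (hα : 0 < α) (hlam : 0 < lam) (hK : 0 ≤ K) (hη : 0 ≤ η)
    (hD : WindowDataF H₀ R ℓ lo hi P9max cdW TRm TNm) (hL : IdealLengthCmpF ℓ lam mu a b w) (hA : IdealAngleCmpF ℓ K η a b w)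
    (hP9 : mu ^ 2 * (P9max : ℝ) ≤ 9 * ϱ ^ 2) (hlo : mu ^ 2 * (lo : ℝ) ≤ 9 * ϱ ^ 2) :
    IsPathSystemOn ϱ a b w (IdealNearF ℓ hi) (dataNpF H₀ cdW) (dataZF H₀ cdW) ∧
      SchemeDominatedOnP ϱ α a b w (dataNpF H₀ cdW) (dataZF H₀ cdW) (IdealNearF ℓ hi) (thetaSumR H₀ R α lam TRm)
        (thetaSumN H₀ R α lam K η TRm TNm) := by
  have key : ∀ x : (Cell 2 × ℤ) × (Cell 2 × ℤ), ϱ < ‖bondVec a b w x‖ → IdealNearF ℓ hi x →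
      ∃ c ∈ cdW x.1.2, dataLookupF H₀ cdW x = some c := by
    intro x hx hN
    have hlo' : lo < n9F (winSeq ℓ H₀ x.1.2) (toWin H₀ x) := by rw [n9F_toWin]; exact lo_lt_n9F_of_far hϱ hL hlo hx
    have hhi' : n9F (winSeq ℓ H₀ x.1.2) (toWin H₀ x) ≤ hi := by rw [n9F_toWin]; exact hN
    exact lookupF_of_complete ((hD x.1.2).1.2.2 _ (isCenterBased_toWin H₀ x) hlo' hhi')
  constructor
  · intro x hx hN
    obtain ⟨c, hc, hcx⟩ := key x hx hN
    have hc1 : c.1 = toWin H₀ x := (lookupF_sound hcx).2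
    have hxe : shiftPairW x.1.1 (wshF H₀ x) c.1 = x := by rw [hc1, shiftPairW_toWin]
    have hn9 : n9F ℓ x = n9F (winSeq ℓ H₀ x.1.2) c.1 := by rw [hc1, n9F_toWin]
    refine ⟨?_, ?_, ?_⟩
    · rw [dataZF_of_lookup hcx, chordNodes_getD_zero]
      exact congrArg Prod.fst hxe
    · rw [dataNpF_of_lookup hcx, dataZF_of_lookup hcx, chordNodes_getD_np]
      exact congrArg Prod.snd hxe
    · intro i hi
      rw [dataNpF_of_lookup hcx] at hi
      rw [piece_dataZF hcx]
      have hpc := ((hD x.1.2).1.1 c hc).2.2 (by rw [← hn9]; exact lo_lt_n9F_of_far hϱ hL hlo hx) (by rw [← hn9]; exact hN) i hi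
      have hq9 : n9F ℓ (shiftPairW x.1.1 (wshF H₀ x) (chordPiece c i)) = n9F (winSeq ℓ H₀ x.1.2) (chordPiece c i) :=
        n9F_shift_win ℓ H₀ x _
      obtain ⟨h1, h2⟩ := hL (shiftPairW x.1.1 (wshF H₀ x) (chordPiece c i))
      rw [hq9] at h1 h2
      have hlo1 : (1 : ℝ) ≤ n9F (winSeq ℓ H₀ x.1.2) (chordPiece c i) := by exact_mod_cast hpc.1
      have hhiP : (n9F (winSeq ℓ H₀ x.1.2) (chordPiece c i) : ℝ) ≤ P9max := by exact_mod_cast hpc.2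
      have hnn := norm_nonneg (bondVec a b w (shiftPairW x.1.1 (wshF H₀ x) (chordPiece c i)))
      constructor
      · rcases hnn.eq_or_lt with h0 | hpos
        · exfalso
          rw [← h0] at h1
          nlinarith
        · exact hpos
      · have hsq : ‖bondVec a b w (shiftPairW x.1.1 (wshF H₀ x) (chordPiece c i))‖ ^ 2 ≤ ϱ ^ 2 := by
          nlinarith [sq_nonneg mu, mul_le_mul_of_nonneg_left hhiP (sq_nonneg mu)]
        exact (pow_le_pow_iff_left₀ hnn hϱ two_ne_zero).mp hsq
  · intro X hX y
    classical
    have hQ : ∀ (x : (Cell 2 × ℤ) × (Cell 2 × ℤ)) (c : ChordDatum) (i : ℕ), dataLookupF H₀ cdW x = some c →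
        piece (dataZF H₀ cdW) x i = y → pieceKeyF (chordPiece c i) = keyAtF H₀ x.1.2 y := by
      intro x c i hcx hP
      rw [piece_dataZF hcx] at hP
      rw [← hP, keyAtF_shift]
    have hinj : ∀ (x x' : (Cell 2 × ℤ) × (Cell 2 × ℤ)) (c : ChordDatum) (i : ℕ), dataLookupF H₀ cdW x = some c →
        dataLookupF H₀ cdW x' = some c → piece (dataZF H₀ cdW) x i = y → piece (dataZF H₀ cdW) x' i = y → x = x' := by
      intro x x' c i hx hx' hP hP'
      rw [piece_dataZF hx] at hP
      rw [piece_dataZF hx'] at hP'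
      have h1 : shiftSiteW x.1.1 (wshF H₀ x) (chordPiece c i).1 = shiftSiteW x'.1.1 (wshF H₀ x') (chordPiece c i).1 :=
        congrArg Prod.fst (hP.trans hP'.symm)
      obtain ⟨hγ, hd⟩ := shiftSiteW_inj h1
      rw [← shiftPairW_toWin H₀ x, ← shiftPairW_toWin H₀ x', ← (lookupF_sound hx).2, ← (lookupF_sound hx').2, hγ, hd]
    -- per base layer `m`: the counting lemma against the window data `cdW m`
    have fibre : ∀ m : ℤ,
        (∑ x ∈ X with x.1.2 = m, ∑ i ∈ Finset.range (dataNpF H₀ cdW x),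
            if piece (dataZF H₀ cdW) x i = y then schemeCoefR α a b w (dataNpF H₀ cdW) (dataZF H₀ cdW) x i else 0) ≤
            (1 + α) * (lam ^ 8)⁻¹ * thetaR0G (winSeq ℓ H₀ m) lo hi (cdW m) (keyAtF H₀ m y) ∧
          (∑ x ∈ X with x.1.2 = m, ∑ i ∈ Finset.range (dataNpF H₀ cdW x),
            if piece (dataZF H₀ cdW) x i = y then schemeCoefN α a b w (dataNpF H₀ cdW) (dataZF H₀ cdW) x i else 0) ≤
            (1 + α⁻¹) * (lam ^ 8)⁻¹ * (K * thetaN0G (winSeq ℓ H₀ m) lo hi (cdW m) (keyAtF H₀ m y) +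
              η * thetaR0G (winSeq ℓ H₀ m) lo hi (cdW m) (keyAtF H₀ m y)) ∧
          0 ≤ (1 + α) * (lam ^ 8)⁻¹ * thetaR0G (winSeq ℓ H₀ m) lo hi (cdW m) (keyAtF H₀ m y) ∧
          0 ≤ (1 + α⁻¹) * (lam ^ 8)⁻¹ * (K * thetaN0G (winSeq ℓ H₀ m) lo hi (cdW m) (keyAtF H₀ m y) +
              η * thetaR0G (winSeq ℓ H₀ m) lo hi (cdW m) (keyAtF H₀ m y)) := by
      intro m
      obtain ⟨hV, _⟩ := hD m
      have hnd : (cdW m).Nodup := List.Nodup.of_map _ hV.2.1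
      have hXm : ∀ x ∈ X.filter (fun x => x.1.2 = m), x ∈ X ∧ x.1.2 = m := fun x hx => Finset.mem_filter.1 hx
      have hlk : ∀ x ∈ X.filter (fun x => x.1.2 = m),
          ∃ c ∈ (cdW m).toFinset, dataLookupF H₀ cdW x = some c ∧ dataNpF H₀ cdW x = chordNp c := by
        intro x hx
        obtain ⟨hxX, hxm⟩ := hXm x hx
        obtain ⟨c, hc, hcx⟩ := key x (hX x hxX).1 (hX x hxX).2
        rw [hxm] at hc
        exact ⟨c, List.mem_toFinset.mpr hc, hcx, dataNpF_of_lookup hcx⟩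
      have hrange : ∀ x ∈ X.filter (fun x => x.1.2 = m), ∀ c, dataLookupF H₀ cdW x = some c →
          lo < n9F (winSeq ℓ H₀ m) c.1 ∧ n9F (winSeq ℓ H₀ m) c.1 ≤ hi := by
        intro x hx c hcx
        obtain ⟨hxX, hxm⟩ := hXm x hx
        have hn9 : n9F ℓ x = n9F (winSeq ℓ H₀ m) c.1 := by rw [(lookupF_sound hcx).2, ← hxm, n9F_toWin]
        exact ⟨by rw [← hn9]; exact lo_lt_n9F_of_far hϱ hL hlo (hX x hxX).1, by rw [← hn9]; exact (hX x hxX).2⟩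
      have hgR : ∀ c ∈ (cdW m).toFinset, ∀ i < chordNp c,
          pieceKeyF (chordPiece c i) = keyAtF H₀ m y ∧ (lo < n9F (winSeq ℓ H₀ m) c.1 ∧ n9F (winSeq ℓ H₀ m) c.1 ≤ hi) →
            0 ≤ (1 + α) * (lam ^ 8)⁻¹ * coefR0F (winSeq ℓ H₀ m) c := by
        intro c _ i _ _
        unfold coefR0F
        positivity
      have hgN : ∀ c ∈ (cdW m).toFinset, ∀ i < chordNp c,
          pieceKeyF (chordPiece c i) = keyAtF H₀ m y ∧ (lo < n9F (winSeq ℓ H₀ m) c.1 ∧ n9F (winSeq ℓ H₀ m) c.1 ≤ hi) →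
            0 ≤ (1 + α⁻¹) * (lam ^ 8)⁻¹ * (K * coefN0F (winSeq ℓ H₀ m) c i + η * coefR0F (winSeq ℓ H₀ m) c) :=
        fun c hc i hi hQi => mul_nonneg (by positivity) (coefN_table_nonnegF hA hV (List.mem_toFinset.mp hc) hQi.2 hi)
      have hR := sum_pieces_le_table (X.filter fun x => x.1.2 = m) (cdW m).toFinset (dataNpF H₀ cdW) chordNp (dataLookupF H₀ cdW)
        (fun x i => piece (dataZF H₀ cdW) x i = y)
        (fun c i => pieceKeyF (chordPiece c i) = keyAtF H₀ m y ∧ (lo < n9F (winSeq ℓ H₀ m) c.1 ∧ n9F (winSeq ℓ H₀ m) c.1 ≤ hi))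
        (schemeCoefR α a b w (dataNpF H₀ cdW) (dataZF H₀ cdW)) (fun c _ => (1 + α) * (lam ^ 8)⁻¹ * coefR0F (winSeq ℓ H₀ m) c) hlk
        (fun x hx c i hcx _ hP => by
          obtain ⟨hxX, hxm⟩ := hXm x hx
          refine ⟨?_, ?_, hrange x hx c hcx⟩
          · have h := schemeCoefR_le_coefR0F hϱ hα hlam hL (hX x hxX).1 hcx i
            rwa [hxm] at h
          · have h := hQ x c i hcx hP
            rwa [hxm] at h)
        hgR (fun x _ x' _ c i hx hx' hP hP' => hinj x x' c i hx hx' hP hP')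
      have hN := sum_pieces_le_table (X.filter fun x => x.1.2 = m) (cdW m).toFinset (dataNpF H₀ cdW) chordNp (dataLookupF H₀ cdW)
        (fun x i => piece (dataZF H₀ cdW) x i = y)
        (fun c i => pieceKeyF (chordPiece c i) = keyAtF H₀ m y ∧ (lo < n9F (winSeq ℓ H₀ m) c.1 ∧ n9F (winSeq ℓ H₀ m) c.1 ≤ hi))
        (schemeCoefN α a b w (dataNpF H₀ cdW) (dataZF H₀ cdW))
        (fun c i => (1 + α⁻¹) * (lam ^ 8)⁻¹ * (K * coefN0F (winSeq ℓ H₀ m) c i + η * coefR0F (winSeq ℓ H₀ m) c)) hlk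
        (fun x hx c i hcx hii hP => by
          obtain ⟨hxX, hxm⟩ := hXm x hx
          refine ⟨?_, ?_, hrange x hx c hcx⟩
          · have hVx : ChordDataValidF H₀ R (winSeq ℓ H₀ x.1.2) lo hi P9max (cdW x.1.2) := by rw [hxm]; exact hV
            have h := schemeCoefN_le_coefN0F hϱ hα hlam hL hA hVx (hX x hxX).1 (lo_lt_n9F_of_far hϱ hL hlo (hX x hxX).1)
              (hX x hxX).2 hcx hii
            rwa [hxm] at h
          · have h := hQ x c i hcx hP
            rwa [hxm] at h)
        hgN (fun x _ x' _ c i hx hx' hP hP' => hinj x x' c i hx hx' hP hP')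
      have hR0 : 0 ≤ ∑ c ∈ (cdW m).toFinset, ∑ i ∈ Finset.range (chordNp c),
          (if pieceKeyF (chordPiece c i) = keyAtF H₀ m y ∧ (lo < n9F (winSeq ℓ H₀ m) c.1 ∧ n9F (winSeq ℓ H₀ m) c.1 ≤ hi) then
            (1 + α) * (lam ^ 8)⁻¹ * coefR0F (winSeq ℓ H₀ m) c else 0) :=
        Finset.sum_nonneg fun c hc => Finset.sum_nonneg fun i hi => by
          split_ifs with hQi
          · exact hgR c hc i (Finset.mem_range.1 hi) hQi
          · exact le_rfl
      have hN0 : 0 ≤ ∑ c ∈ (cdW m).toFinset, ∑ i ∈ Finset.range (chordNp c),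
          (if pieceKeyF (chordPiece c i) = keyAtF H₀ m y ∧ (lo < n9F (winSeq ℓ H₀ m) c.1 ∧ n9F (winSeq ℓ H₀ m) c.1 ≤ hi) then
            (1 + α⁻¹) * (lam ^ 8)⁻¹ * (K * coefN0F (winSeq ℓ H₀ m) c i + η * coefR0F (winSeq ℓ H₀ m) c) else 0) :=
        Finset.sum_nonneg fun c hc => Finset.sum_nonneg fun i hi => by
          split_ifs with hQi
          · exact hgN c hc i (Finset.mem_range.1 hi) hQi
          · exact le_rfl
      rw [tableRG_eq hnd] at hR hR0
      rw [tableNG_eq hnd] at hN hN0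
      exact ⟨hR, hN, hR0, hN0⟩
    -- assemble over the base layers: only the layers within `R` of `y.1.2` carry incidences with piece `y`
    have hmaps : ∀ x ∈ X, (fun x : (Cell 2 × ℤ) × (Cell 2 × ℤ) => x.1.2) x ∈ X.image (fun x : (Cell 2 × ℤ) × (Cell 2 × ℤ) => x.1.2) :=
      fun x hx => Finset.mem_image_of_mem _ hx
    have zeroR : ∀ m, m ∉ Finset.Icc (y.1.2 - R) (y.1.2 + R) → thetaR0G (winSeq ℓ H₀ m) lo hi (cdW m) (keyAtF H₀ m y) = 0 :=
      fun m hm => thetaR0G_eq_zero_of_far (hD m).1 fun h => hm (mem_Icc_of_key h)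
    have zeroN : ∀ m, m ∉ Finset.Icc (y.1.2 - R) (y.1.2 + R) → thetaN0G (winSeq ℓ H₀ m) lo hi (cdW m) (keyAtF H₀ m y) = 0 :=
      fun m hm => thetaN0G_eq_zero_of_far (hD m).1 fun h => hm (mem_Icc_of_key h)
    constructor
    · calc (∑ x ∈ X, ∑ i ∈ Finset.range (dataNpF H₀ cdW x),
            if piece (dataZF H₀ cdW) x i = y then schemeCoefR α a b w (dataNpF H₀ cdW) (dataZF H₀ cdW) x i else 0)
          = ∑ m ∈ X.image (fun x : (Cell 2 × ℤ) × (Cell 2 × ℤ) => x.1.2), ∑ x ∈ X with x.1.2 = m,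
              ∑ i ∈ Finset.range (dataNpF H₀ cdW x),
                if piece (dataZF H₀ cdW) x i = y then schemeCoefR α a b w (dataNpF H₀ cdW) (dataZF H₀ cdW) x i else 0 :=
            (Finset.sum_fiberwise_of_maps_to hmaps _).symm
        _ ≤ ∑ m ∈ X.image (fun x : (Cell 2 × ℤ) × (Cell 2 × ℤ) => x.1.2),
              (1 + α) * (lam ^ 8)⁻¹ * thetaR0G (winSeq ℓ H₀ m) lo hi (cdW m) (keyAtF H₀ m y) :=
            Finset.sum_le_sum fun m _ => (fibre m).1
        _ = ∑ m ∈ X.image (fun x : (Cell 2 × ℤ) × (Cell 2 × ℤ) => x.1.2) with m ∈ Finset.Icc (y.1.2 - R) (y.1.2 + R),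
              (1 + α) * (lam ^ 8)⁻¹ * thetaR0G (winSeq ℓ H₀ m) lo hi (cdW m) (keyAtF H₀ m y) :=
            (Finset.sum_filter_of_ne fun m _ hne => by
              by_contra hm
              exact hne (by rw [zeroR m hm, mul_zero])).symm
        _ ≤ ∑ m ∈ Finset.Icc (y.1.2 - R) (y.1.2 + R), (1 + α) * (lam ^ 8)⁻¹ * thetaR0G (winSeq ℓ H₀ m) lo hi (cdW m) (keyAtF H₀ m y) :=
            Finset.sum_le_sum_of_subset_of_nonneg (fun m hm => (Finset.mem_filter.1 hm).2) fun m _ _ => (fibre m).2.2.1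
        _ ≤ ∑ m ∈ Finset.Icc (y.1.2 - R) (y.1.2 + R), (1 + α) * (lam ^ 8)⁻¹ * TRm m (keyAtF H₀ m y) :=
            Finset.sum_le_sum fun m _ => mul_le_mul_of_nonneg_left ((hD m).2 _).1 (by positivity)
        _ = thetaSumR H₀ R α lam TRm y := by rw [thetaSumR, Finset.mul_sum]
    · calc (∑ x ∈ X, ∑ i ∈ Finset.range (dataNpF H₀ cdW x),
            if piece (dataZF H₀ cdW) x i = y then schemeCoefN α a b w (dataNpF H₀ cdW) (dataZF H₀ cdW) x i else 0)
          = ∑ m ∈ X.image (fun x : (Cell 2 × ℤ) × (Cell 2 × ℤ) => x.1.2), ∑ x ∈ X with x.1.2 = m,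
              ∑ i ∈ Finset.range (dataNpF H₀ cdW x),
                if piece (dataZF H₀ cdW) x i = y then schemeCoefN α a b w (dataNpF H₀ cdW) (dataZF H₀ cdW) x i else 0 :=
            (Finset.sum_fiberwise_of_maps_to hmaps _).symm
        _ ≤ ∑ m ∈ X.image (fun x : (Cell 2 × ℤ) × (Cell 2 × ℤ) => x.1.2), (1 + α⁻¹) * (lam ^ 8)⁻¹ *
              (K * thetaN0G (winSeq ℓ H₀ m) lo hi (cdW m) (keyAtF H₀ m y) + η * thetaR0G (winSeq ℓ H₀ m) lo hi (cdW m) (keyAtF H₀ m y)) :=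
            Finset.sum_le_sum fun m _ => (fibre m).2.1
        _ = ∑ m ∈ X.image (fun x : (Cell 2 × ℤ) × (Cell 2 × ℤ) => x.1.2) with m ∈ Finset.Icc (y.1.2 - R) (y.1.2 + R),
              (1 + α⁻¹) * (lam ^ 8)⁻¹ *
              (K * thetaN0G (winSeq ℓ H₀ m) lo hi (cdW m) (keyAtF H₀ m y) + η * thetaR0G (winSeq ℓ H₀ m) lo hi (cdW m) (keyAtF H₀ m y)) :=
            (Finset.sum_filter_of_ne fun m _ hne => by
              by_contra hm
              exact hne (by rw [zeroR m hm, zeroN m hm, mul_zero, mul_zero, add_zero, mul_zero])).symm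
        _ ≤ ∑ m ∈ Finset.Icc (y.1.2 - R) (y.1.2 + R), (1 + α⁻¹) * (lam ^ 8)⁻¹ *
              (K * thetaN0G (winSeq ℓ H₀ m) lo hi (cdW m) (keyAtF H₀ m y) + η * thetaR0G (winSeq ℓ H₀ m) lo hi (cdW m) (keyAtF H₀ m y)) :=
            Finset.sum_le_sum_of_subset_of_nonneg (fun m hm => (Finset.mem_filter.1 hm).2) fun m _ _ => (fibre m).2.2.2
        _ ≤ ∑ m ∈ Finset.Icc (y.1.2 - R) (y.1.2 + R), (1 + α⁻¹) * (lam ^ 8)⁻¹ *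
              (K * TNm m (keyAtF H₀ m y) + η * TRm m (keyAtF H₀ m y)) :=
            Finset.sum_le_sum fun m _ => mul_le_mul_of_nonneg_left
              (add_le_add (mul_le_mul_of_nonneg_left ((hD m).2 _).2 hK) (mul_le_mul_of_nonneg_left ((hD m).2 _).1 hη)) (by positivity)
        _ = thetaSumN H₀ R α lam K η TRm TNm y := by rw [thetaSumN, Finset.mul_sum]

/-- ★ THE KERNEL FEEDS THE READER: the windowed kernel contract of every window TYPE `windowWord ℓ (m − H₀) (2H₀+1)` of a letter sequence
gives window data with the dyadic majorants. [g100] -/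
theorem windowDataF_of_kernel {H₀ R : ℕ} {ℓ : ℤ → ℤ} {lo hi P9max : ℤ} {E : ℕ} {cdK : ℤ → List ChordDatum}
    {TRK TNK : ℤ → ℤ × ℤ × ℤ × ℤ → ℤ} (hℓ : IsLetterSeq ℓ)
    (hK : ∀ m : ℤ, KernelSlabSoundF H₀ R (windowWord ℓ (m - H₀) (2 * H₀ + 1)) lo hi P9max E (cdK m) (TRK m) (TNK m)) :
    WindowDataF H₀ R ℓ lo hi P9max cdK (fun m k => (TRK m k : ℝ) / 2 ^ E) (fun m k => (TNK m k : ℝ) / 2 ^ E) := by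
  intro m
  have hag : AgreesOnWindow H₀ (windowWord ℓ (m - H₀) (2 * H₀ + 1)) (winSeq ℓ H₀ m) := by
    intro j h0 hj
    unfold winSeq
    rw [regW_windowWord ℓ (m - H₀) h0 (by push_cast; omega)]
    congr 1; ring
  exact hK m (winSeq ℓ H₀ m) (isLetterSeq_winSeq hℓ H₀ m) hag

/-- ★★ COROLLARY (what a letter-function box certificate invokes): kernel contracts for the window types of `ℓ` + the comparisons ⇒ path
system and domination by the dyadic layer sums on the far ideal-near pairs of `ℓ`. [g100] -/
theorem thetaReaderNearF_of_kernel {H₀ R : ℕ} {ℓ : ℤ → ℤ} {lo hi P9max : ℤ} {E : ℕ} {cdK : ℤ → List ChordDatum}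
    {TRK TNK : ℤ → ℤ × ℤ × ℤ × ℤ → ℤ} {ϱ α lam mu K η : ℝ} {a b : E3} {w : ℤ → E3} (hℓ : IsLetterSeq ℓ) (hϱ : 0 ≤ ϱ) (hα : 0 < α)
    (hlam : 0 < lam) (hK0 : 0 ≤ K) (hη : 0 ≤ η)
    (hK : ∀ m : ℤ, KernelSlabSoundF H₀ R (windowWord ℓ (m - H₀) (2 * H₀ + 1)) lo hi P9max E (cdK m) (TRK m) (TNK m))
    (hL : IdealLengthCmpF ℓ lam mu a b w) (hA : IdealAngleCmpF ℓ K η a b w) (hP9 : mu ^ 2 * (P9max : ℝ) ≤ 9 * ϱ ^ 2)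
    (hlo : mu ^ 2 * (lo : ℝ) ≤ 9 * ϱ ^ 2) :
    IsPathSystemOn ϱ a b w (IdealNearF ℓ hi) (dataNpF H₀ cdK) (dataZF H₀ cdK) ∧
      SchemeDominatedOnP ϱ α a b w (dataNpF H₀ cdK) (dataZF H₀ cdK) (IdealNearF ℓ hi)
        (thetaSumR H₀ R α lam fun m k => (TRK m k : ℝ) / 2 ^ E)
        (thetaSumN H₀ R α lam K η (fun m k => (TRK m k : ℝ) / 2 ^ E) fun m k => (TNK m k : ℝ) / 2 ^ E) :=
  thetaReaderNearF_holds hϱ hα hlam hK0 hη (windowDataF_of_kernel hℓ hK) hL hA hP9 hlo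

end Summit.AtomisticToContinuum.Crystallization.Theorems.ChartedZeroExcessLayeredLatticeLiouville
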